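import Literature.LinearAlgebra.SemisimpleOperatorInvariantSums
import Literature.LinearAlgebra.TateCommutantBaseChange
import Mathlib.LinearAlgebra.Dual.BaseChange
import HarnessLib

/-!
# Milne's semisimplicity criterion in abstract form: `Ker(Φ − 1) ∩ (Φ − 1)M = 0` for a «Künneth»
# endomorphism `Φ ⊇ F ⊗ ψ` forces the generalized eigenspaces of `F` to be eigenspaces; and
# semisimplicity descends along extension of scalars

Topic `LinearAlgebra`; THEOREMS ONLY (no definition, no instance, no named fact; D-0026).

J. S. Milne, *The Tate conjecture over finite fields* (arXiv:0709.3040, held, p. 3–4): «Theorem 1.3.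
Let `X` be a variety over `𝔽` of dimension `d`. If `S^{2d}(X × X, ℓ)` is true, then every Frobenius map
`π` acts semisimply on `H^*(X, ℚ_ℓ)`.  PROOF. If `a` occurs as an eigenvalue of `π` on `H^r(X, ℚ_ℓ)`,
then `1/a` occurs as an eigenvalue of `π` on `H^{2d−r}(X, ℚ_ℓ(d))` (by Poincaré duality), and
`H^r(X, ℚ_ℓ)_a ⊗ H^{2d−r}(X, ℚ_ℓ(d))_{1/a} ⊂ H^{2d}(X × X, ℚ_ℓ(d))_1` (Künneth formula), from which the
claim follows.»  B. Kahn, *Zeta and L-functions of varieties and motives* (2020) Th. 6.54 (held,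
p. 132): «`S^d(X × X, l) ⟺ SS^i(X, l)` for all `i`.»

The tree's `GaloisWeilCohomology.maxGenEigenspace_frobAction_eq_eigenspace` (gen 37) is this
argument written directly on the cohomology of the abstract `E`, for eigenvalues IN the coefficient
field `K`; Kahn's theorem needs it for all eigenvalues, i.e. after extension of scalars.  This file
isolates the LINEAR ALGEBRA so that it can be run over any field, in particular over `K̄`:

* §1 **THE ABSTRACT MILNE ARGUMENT** (`maxGenEigenspace_eq_eigenspace_of_kunneth`): `L` a field,
  `F ∈ End V` injective, `ψ ∈ End W` such that «`μ` eigenvalue of `F` ⟹ `μ⁻¹` eigenvalue of `ψ`»,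
  a bilinear `κ : V × W → M` with `κ(Fa, ψb) = Φ κ(a, b)` and `κ(a, b) = 0 ⟹ a = 0 ∨ b = 0`, and
  `Ker(Φ − 1) ∩ (Φ − 1)M = 0`.  Then EVERY generalized eigenspace of `F` (for `μ ∈ L`) is the
  eigenspace.  With an invariant perfect pairing `B(Fv, ψw) = B(v, w)` the eigenvalue hypothesis holds
  (`eigenspace_inv_ne_bot_of_pairing`, Milne's «by Poincaré duality»;
  `maxGenEigenspace_eq_eigenspace_of_kunneth_pairing`).  If moreover the characteristic polynomial of
  `F` SPLITS over `L` (e.g. `L` algebraically closed), `F` IS SEMISIMPLE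
  (`isSemisimple_of_kunneth_of_splits`, via the tree's
  `isSemisimple_iff_forall_maxGenEigenspace_eq_eigenspace_of_splits`).
* §2 **DESCENT OF SEMISIMPLICITY**: for any field extension `L/K` and `f ∈ End_K(V)`, if
  `f_L = 1 ⊗ f` is semisimple on `L ⊗_K V` then `f` is semisimple
  (`isSemisimple_of_isSemisimple_baseChange`): the minimal polynomial of `f` is squarefree because the
  annihilator of `f_L` is a radical ideal and `End_K(V) → End_L(V_L)` is injective
  (`aeval_baseChange_map_eq_zero_iff`).  With the tree's ascent `IsSemisimple.baseChange_of_perfectField`: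
  **over a perfect field, `f` is semisimple iff `f_L` is** (`isSemisimple_iff_isSemisimple_baseChange`).

What this file does NOT do: the base change of the Künneth data themselves (pairing, `κ`, the `S`
condition) is left to the sequel; nothing here mentions cohomology.

## Provenance

Lane `lit-hodgefound` (summit `HodgeConjecture`, Track 2 foundations library, Layer B: motives),
seat `lit-hodgefound-p29` (literature-prover, generation 39, row g39-#5).
-/

open Module Module.End Polynomial
open scoped TensorProduct

namespace Literature.LinearAlgebra

/-! ## §1 The abstract Milne argument -/

section Milne

variable {L : Type*} [Field L]
variable {V : Type*} [AddCommGroup V] [Module L V]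
variable {W : Type*} [AddCommGroup W] [Module L W]
variable {M : Type*} [AddCommGroup M] [Module L M]

/-- **Milne's «by Poincaré duality» step**: for a perfect pairing `B` with `B(Fv, ψw) = B(v, w)` and
`μ ≠ 0`, if `μ` is an eigenvalue of `F` then `μ⁻¹` is an eigenvalue of `ψ` (indeed the eigenspaces have
the same dimension: the pair `(μ⁻¹F, μψ)` leaves `B` invariant and the tree's
`InvariantPairing.finrank_ker_sub_one_eq` applies). [cite: Milne2007TateFiniteFieldsAIM, Th. 1.3 (proof)] -/
theorem finrank_eigenspace_inv_eq_of_pairing [FiniteDimensional L V] (B : V →ₗ[L] W →ₗ[L] L)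
    [B.IsPerfPair] {F : Module.End L V} {ψ : Module.End L W} (h : ∀ v w, B (F v) (ψ w) = B v w)
    {μ : L} (hμ : μ ≠ 0) :
    finrank L (ψ.eigenspace μ⁻¹) = finrank L (F.eigenspace μ) := by
  have h' : ∀ v w, B ((μ⁻¹ • F) v) ((μ • ψ) w) = B v w := fun v w ↦ by
    simp only [LinearMap.smul_apply, map_smul]
    rw [h v w, smul_smul, mul_inv_cancel₀ hμ, one_smul]
  have hF : LinearMap.ker (μ⁻¹ • F - 1) = F.eigenspace μ := by
    ext v
    simp only [LinearMap.mem_ker, LinearMap.sub_apply, LinearMap.smul_apply, Module.End.one_apply,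
      sub_eq_zero, Module.End.mem_eigenspace_iff]
    constructor
    · intro hv
      have := congrArg (μ • ·) hv
      simpa only [smul_smul, mul_inv_cancel₀ hμ, one_smul] using this
    · intro hv
      rw [hv, smul_smul, inv_mul_cancel₀ hμ, one_smul]
  have hψ : LinearMap.ker (μ • ψ - 1) = ψ.eigenspace μ⁻¹ := by
    ext w
    simp only [LinearMap.mem_ker, LinearMap.sub_apply, LinearMap.smul_apply, Module.End.one_apply,
      sub_eq_zero, Module.End.mem_eigenspace_iff]
    constructor
    · intro hw
      have := congrArg (μ⁻¹ • ·) hw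
      simpa only [smul_smul, inv_mul_cancel₀ hμ, one_smul] using this
    · intro hw
      rw [hw, smul_smul, mul_inv_cancel₀ hμ, one_smul]
  rw [← hψ, ← hF]
  exact InvariantPairing.finrank_ker_sub_one_eq B h'

/-- **`μ` eigenvalue of `F` ⟹ `μ⁻¹` eigenvalue of `ψ`** for an invariant perfect pairing
(`B(Fv, ψw) = B(v, w)`, `μ ≠ 0`). [cite: Milne2007TateFiniteFieldsAIM, Th. 1.3 (proof)] -/
theorem eigenspace_inv_ne_bot_of_pairing [FiniteDimensional L V] [FiniteDimensional L W]
    (B : V →ₗ[L] W →ₗ[L] L) [B.IsPerfPair] {F : Module.End L V} {ψ : Module.End L W}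
    (h : ∀ v w, B (F v) (ψ w) = B v w) {μ : L} (hμ : μ ≠ 0) (hF : F.eigenspace μ ≠ ⊥) :
    ψ.eigenspace μ⁻¹ ≠ ⊥ := by
  intro hbot
  have h0 : finrank L (F.eigenspace μ) = 0 := by
    rw [← finrank_eigenspace_inv_eq_of_pairing B h hμ, hbot, finrank_bot]
  exact hF (Submodule.finrank_eq_zero.mp h0)

/-- **THE ABSTRACT MILNE ARGUMENT (Milne 2007 Th. 1.3 / Kahn 2020 Th. 6.54 ⟹)**: `F ∈ End V` injective,
`ψ ∈ End W` with «`μ` eigenvalue of `F`, `μ ≠ 0` ⟹ `μ⁻¹` eigenvalue of `ψ`», a bilinear «Künneth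
product» `κ : V × W → M` with `κ(Fa, ψb) = Φ κ(a, b)` and without zero divisors, and the `S` condition
`Ker(Φ − 1) ∩ (Φ − 1)M = 0`.  Then for every `μ ∈ L` the generalized eigenspace of `F` for `μ` is the
eigenspace: for `(F − μ)²v = 0`, `u = (F − μ)v ≠ 0`, `w ≠ 0` with `ψw = μ⁻¹w`, the element `κ(u, w) ≠ 0`
is fixed by `Φ` and equals `μ (Φ − 1) κ(v, w)`. [cite: Milne2007TateFiniteFieldsAIM, Th. 1.3]
[cite: Kahn2020, §6.14 Th. 6.54] -/
theorem maxGenEigenspace_eq_eigenspace_of_kunneth (F : Module.End L V) (ψ : Module.End L W)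
    (Φ : Module.End L M) (hFinj : Function.Injective F)
    (hψ : ∀ μ : L, μ ≠ 0 → F.eigenspace μ ≠ ⊥ → ψ.eigenspace μ⁻¹ ≠ ⊥)
    (κ : V →ₗ[L] W →ₗ[L] M) (hκ : ∀ a b, κ (F a) (ψ b) = Φ (κ a b))
    (hκ0 : ∀ a b, κ a b = 0 → a = 0 ∨ b = 0)
    (hS : LinearMap.ker (Φ - 1) ⊓ LinearMap.range (Φ - 1) = ⊥) (μ : L) :
    F.maxGenEigenspace μ = F.eigenspace μ := by
  rw [InvariantPairing.maxGenEigenspace_eq_eigenspace_iff]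
  refine le_antisymm (fun v hv ↦ ?_) (fun v hv ↦ ?_)
  swap
  · rw [LinearMap.mem_ker] at hv ⊢
    rw [pow_two, Module.End.mul_apply, hv, map_zero]
  rw [LinearMap.mem_ker] at hv ⊢
  by_contra hu
  set u := (F - μ • 1) v with hu_def
  -- `u` is an eigenvector for `μ`
  have hFu : F u = μ • u := by
    have : (F - μ • 1) u = 0 := by rw [hu_def, ← Module.End.mul_apply, ← pow_two, hv]
    simpa [sub_eq_zero] using this
  -- `F` is injective, so `μ ≠ 0`
  have hμ : μ ≠ 0 := by
    rintro rfl
    rw [zero_smul] at hFu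
    exact hu (hFinj (by rw [hFu, map_zero]))
  -- an eigenvector `w ≠ 0` of `ψ` for `μ⁻¹`
  have hne : F.eigenspace μ ≠ ⊥ := by
    intro hbot
    have : u ∈ F.eigenspace μ := Module.End.mem_eigenspace_iff.mpr hFu
    rw [hbot, Submodule.mem_bot] at this
    exact hu this
  obtain ⟨w, hw, hw0⟩ := (Submodule.ne_bot_iff _).mp (hψ μ hμ hne)
  have hψw : ψ w = μ⁻¹ • w := Module.End.mem_eigenspace_iff.mp hw
  -- `y = κ(u, w) ≠ 0` is fixed by `Φ` and is `μ (Φ − 1) κ(v, w)`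
  have hy0 : κ u w ≠ 0 := fun h0 ↦ by
    rcases hκ0 u w h0 with h | h
    · exact hu h
    · exact hw0 h
  have hΦy : Φ (κ u w) = κ u w := by
    rw [← hκ u w, hFu, hψw, map_smul, map_smul, LinearMap.smul_apply, smul_smul, inv_mul_cancel₀ hμ,
      one_smul]
  have hΦx : (Φ - 1) (κ v w) = μ⁻¹ • κ u w := by
    rw [LinearMap.sub_apply, Module.End.one_apply, ← hκ v w, hψw, map_smul, hu_def,
      LinearMap.sub_apply, LinearMap.smul_apply, Module.End.one_apply, map_sub, LinearMap.sub_apply,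
      map_smul, LinearMap.smul_apply, smul_sub, smul_smul, inv_mul_cancel₀ hμ, one_smul]
  have hmem : κ u w ∈ LinearMap.ker (Φ - 1) ⊓ LinearMap.range (Φ - 1) := by
    refine Submodule.mem_inf.mpr ⟨?_, ?_⟩
    · rw [LinearMap.mem_ker, LinearMap.sub_apply, Module.End.one_apply, hΦy, sub_self]
    · refine LinearMap.mem_range.mpr ⟨μ • κ v w, ?_⟩
      rw [map_smul, hΦx, smul_smul, mul_inv_cancel₀ hμ, one_smul]
  rw [hS, Submodule.mem_bot] at hmem
  exact hy0 hmem

/-- **The same with an invariant perfect pairing** supplying the eigenvalue `μ⁻¹` of `ψ` (Milne's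
statement: `F` and `ψ` the Frobenius of `Hⁱ(X)` and of `H^{2d−i}(X)(d)`, `B` the Poincaré pairing, `κ`
the Künneth product into `H^{2d}(X × X)(d)` with its twisted Frobenius `Φ`).
[cite: Milne2007TateFiniteFieldsAIM, Th. 1.3] [cite: Kahn2020, §6.14 Th. 6.54] -/
theorem maxGenEigenspace_eq_eigenspace_of_kunneth_pairing [FiniteDimensional L V]
    [FiniteDimensional L W] (B : V →ₗ[L] W →ₗ[L] L) [B.IsPerfPair] (F : Module.End L V)
    (ψ : Module.End L W) (Φ : Module.End L M) (hB : ∀ v w, B (F v) (ψ w) = B v w)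
    (κ : V →ₗ[L] W →ₗ[L] M) (hκ : ∀ a b, κ (F a) (ψ b) = Φ (κ a b))
    (hκ0 : ∀ a b, κ a b = 0 → a = 0 ∨ b = 0)
    (hS : LinearMap.ker (Φ - 1) ⊓ LinearMap.range (Φ - 1) = ⊥) (μ : L) :
    F.maxGenEigenspace μ = F.eigenspace μ :=
  maxGenEigenspace_eq_eigenspace_of_kunneth F ψ Φ (InvariantPairing.injective_left B hB)
    (fun _ hμ hne ↦ eigenspace_inv_ne_bot_of_pairing B hB hμ hne) κ hκ hκ0 hS μ

/-- **`F` IS SEMISIMPLE** under the hypotheses of the abstract Milne argument when its characteristic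
polynomial splits over `L` (e.g. `L` algebraically closed): all generalized eigenspaces are
eigenspaces (the tree's `isSemisimple_iff_forall_maxGenEigenspace_eq_eigenspace_of_splits`).
[cite: Milne2007TateFiniteFieldsAIM, Th. 1.3] [cite: Kahn2020, §6.14 Th. 6.54] -/
theorem isSemisimple_of_kunneth_of_splits [FiniteDimensional L V] (F : Module.End L V)
    (ψ : Module.End L W) (Φ : Module.End L M) (hFinj : Function.Injective F)
    (hψ : ∀ μ : L, μ ≠ 0 → F.eigenspace μ ≠ ⊥ → ψ.eigenspace μ⁻¹ ≠ ⊥)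
    (κ : V →ₗ[L] W →ₗ[L] M) (hκ : ∀ a b, κ (F a) (ψ b) = Φ (κ a b))
    (hκ0 : ∀ a b, κ a b = 0 → a = 0 ∨ b = 0)
    (hS : LinearMap.ker (Φ - 1) ⊓ LinearMap.range (Φ - 1) = ⊥) (hsplit : F.charpoly.Splits) :
    F.IsSemisimple :=
  (isSemisimple_iff_forall_maxGenEigenspace_eq_eigenspace_of_splits F hsplit).mpr
    fun μ ↦ maxGenEigenspace_eq_eigenspace_of_kunneth F ψ Φ hFinj hψ κ hκ hκ0 hS μ

/-- The pairing form of the semisimplicity conclusion (split characteristic polynomial).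
[cite: Milne2007TateFiniteFieldsAIM, Th. 1.3] [cite: Kahn2020, §6.14 Th. 6.54] -/
theorem isSemisimple_of_kunneth_pairing_of_splits [FiniteDimensional L V] [FiniteDimensional L W]
    (B : V →ₗ[L] W →ₗ[L] L) [B.IsPerfPair] (F : Module.End L V) (ψ : Module.End L W)
    (Φ : Module.End L M) (hB : ∀ v w, B (F v) (ψ w) = B v w)
    (κ : V →ₗ[L] W →ₗ[L] M) (hκ : ∀ a b, κ (F a) (ψ b) = Φ (κ a b))
    (hκ0 : ∀ a b, κ a b = 0 → a = 0 ∨ b = 0)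
    (hS : LinearMap.ker (Φ - 1) ⊓ LinearMap.range (Φ - 1) = ⊥) (hsplit : F.charpoly.Splits) :
    F.IsSemisimple :=
  (isSemisimple_iff_forall_maxGenEigenspace_eq_eigenspace_of_splits F hsplit).mpr
    fun μ ↦ maxGenEigenspace_eq_eigenspace_of_kunneth_pairing B F ψ Φ hB κ hκ hκ0 hS μ

end Milne

/-! ## §2 Descent of semisimplicity along extension of scalars -/

section Descent

variable {K : Type*} [Field K] {V : Type*} [AddCommGroup V] [Module K V]
variable (L : Type*) [Field L] [Algebra K L]

/-- **`End_K(V) → End_L(L ⊗_K V)` is injective**: `f_L = 0 ⟹ f = 0` (test against `1 ⊗ v` with the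
base-changed linear forms `φ_L(1 ⊗ v) = φ(v)`).  PRIVATE local copy of the endomorphism case of the
tree's `Literature.AlgebraicGeometry.Motives.AbelianVariety.baseChange_eq_zero_iff`
(`AbelianVarietyCotangentHomBaseChange`), to keep this file inside `LinearAlgebra`. [folklore] -/
private theorem baseChange_eq_zero_iff (f : Module.End K V) : f.baseChange L = 0 ↔ f = 0 := by
  refine ⟨fun h ↦ LinearMap.ext fun v ↦ ?_, fun h ↦ by rw [h, LinearMap.baseChange_zero]⟩
  rw [LinearMap.zero_apply]
  refine (Module.forall_dual_apply_eq_zero_iff K (f v)).mp fun φ ↦ ?_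
  have h1 : (φ.baseChange L) ((1 : L) ⊗ₜ[K] f v) = 0 := by
    rw [← LinearMap.baseChange_tmul, h, LinearMap.zero_apply, map_zero]
  rw [Module.Dual.baseChange_apply_tmul, Algebra.smul_def, mul_one] at h1
  exact (map_eq_zero_iff _ (algebraMap K L).injective).mp h1

/-- `p(f)_L = 0 ⟺ p(f) = 0` for a polynomial `p ∈ K[X]` (base change along a field extension is
faithfully flat: it reflects the vanishing of linear maps). [cite: GortzWedhorn2020, Remark 6.12 (2)–(3)] -/
theorem aeval_baseChange_map_eq_zero_iff (f : Module.End K V) (p : K[X]) :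
    aeval (f.baseChange L) (p.map (algebraMap K L)) = 0 ↔ aeval f p = 0 := by
  rw [← baseChange_aeval, baseChange_eq_zero_iff]

/-- **DESCENT: if `f_L` is a semisimple endomorphism of `L ⊗_K V` then `f` is semisimple** (any field
extension `L/K`, `V` finite-dimensional): the minimal polynomial `m` of `f` is squarefree — if
`m = d²e` then `((de)_L)²` kills `f_L`, so `(de)_L` does (the annihilator of a semisimple endomorphism
is a radical ideal), so `de` kills `f` and `d²e ∣ de`. [cite: Kahn2020, §6.14 Th. 6.54 (statement over ℚ̄_ℓ versus ℚ_ℓ)] -/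
theorem isSemisimple_of_isSemisimple_baseChange [FiniteDimensional K V] (f : Module.End K V)
    (h : Module.End.IsSemisimple (f.baseChange L)) : f.IsSemisimple := by
  refine Module.End.isSemisimple_of_squarefree_aeval_eq_zero (p := minpoly K f) ?_ (minpoly.aeval K f)
  intro d hd
  obtain ⟨e, he⟩ := hd
  have hm0 : minpoly K f ≠ 0 := minpoly.ne_zero (Algebra.IsIntegral.isIntegral f)
  -- `((d e)_L)²` kills `f_L`
  have h1 : aeval (f.baseChange L) ((((d * e).map (algebraMap K L))) ^ 2) = 0 := by
    have hsq : (d * e) ^ 2 = minpoly K f * e := by rw [he]; ring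
    rw [← Polynomial.map_pow, hsq, Polynomial.map_mul, map_mul,
      (aeval_baseChange_map_eq_zero_iff L f _).mpr (minpoly.aeval K f), zero_mul]
  -- radical annihilator: `(d e)_L` kills `f_L`
  have h2 : aeval (f.baseChange L) ((d * e).map (algebraMap K L)) = 0 := by
    rw [← RingHom.mem_ker, ← Module.AEval.annihilator_eq_ker_aeval (M := L ⊗[K] V)] at h1 ⊢
    exact h.annihilator_isRadical _ _ ⟨2, h1⟩
  -- hence `d e` kills `f`, `m ∣ d e`, and `d` is a unit
  have h3 : aeval f (d * e) = 0 := (aeval_baseChange_map_eq_zero_iff L f _).mp h2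
  have h4 : minpoly K f ∣ d * e := minpoly.dvd K f h3
  rw [he] at h4 hm0
  have hd0 : d ≠ 0 := fun h0 ↦ hm0 (by rw [h0, zero_mul, zero_mul])
  have he0 : e ≠ 0 := fun h0 ↦ hm0 (by rw [h0, mul_zero])
  obtain ⟨c, hc⟩ := h4
  -- `d * e = d * d * e * c` ⟹ `d * c = 1`
  have hde : d * e ≠ 0 := mul_ne_zero hd0 he0
  have h5 : d * e * 1 = d * e * (d * c) := by
    rw [mul_one]
    conv_lhs => rw [hc]
    ring
  exact IsUnit.of_mul_eq_one c (mul_left_cancel₀ hde h5).symm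

/-- **Over a perfect field `K`, `f` is semisimple iff `f_L` is**, for any extension `L/K` (ascent is
the tree's `IsSemisimple.baseChange_of_perfectField`, descent is
`isSemisimple_of_isSemisimple_baseChange`). [cite: Kahn2020, §6.14 Th. 6.54 (over ℚ̄_ℓ)]
[cite: Milne1999, §7 p. 75 L7–L9] -/
theorem isSemisimple_iff_isSemisimple_baseChange [PerfectField K] [FiniteDimensional K V]
    (f : Module.End K V) : f.IsSemisimple ↔ Module.End.IsSemisimple (f.baseChange L) :=
  ⟨fun h ↦ IsSemisimple.baseChange_of_perfectField L h, isSemisimple_of_isSemisimple_baseChange L f⟩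

end Descent

end Literature.LinearAlgebra
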